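import Mathlib.Analysis.CStarAlgebra.Matrix
import Literature.MathematicalPhysics.QuantumFieldTheory.Balaban1983to89.B7Prop2Explicit
import Literature.MathematicalPhysics.QuantumFieldTheory.Balaban1983to89.B9Cor36CubeCutoffs

/-!
# `Balaban1983to89.B9CubeDataHermitianPart` — THE (3.35) CUBE DATA AT THE UNITARY MATRIX FIBRE HAVE A HERMITIAN REPRESENTATIVE: from the twelve per-cube
# clauses of the member assembler's target (`B8Thm2TorusCoverOfDeltaAAssembler.hThm2Cover_of_prop6_deltaAAssembler`) at a `U(N)`-valued background with
# bi-contractive gauges, the potentials `A_□` may be replaced by their Hermitian parts `½(A_□ + A_□⋆)` — the clauses still hold, and the located letters'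
# THIRTEENTH clause `‖e^{itA_□(b)}‖ ≤ 1` (M5.1b-G `sum_conj_famFour_at_locCfg'`, `sum_conj_locDefect_at_locCfg'`, `eBlock_locLetterBY''`) holds as well
# (the bond-sector member ASSEMBLER, file H; seat p33 gen 105)

T. Bałaban, *Propagators for lattice gauge theories in a background field*, Commun. Math. Phys. **99** (1985) 389–434 [`Balaban1985BackgroundPropagators`,
"B9"]: (3.35)–(3.37) p. 396, Cor. 3.6 p. 408 («U′ = U^u = e^{iηA}»), (3.28) p. 395.  T. Bałaban, *Averaging operations for lattice gauge theories*, Commun.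
Math. Phys. **98** (1985) 17–51 [`Balaban1985Averaging`, "B7"]: (22)–(23) p. 21 (the logarithm of a unitary near `1` is `i`·(hermitian)).

statement-level skeleton of published theorems with citation tags; proofs where landed; nothing here is a claim about the Yang–Mills mass gap

WHY THIS FILE (cell `lit-balaban`; scope memo `run/shared/lean/pub/lit-balaban/lit-balaban-p33/g105/ASSEMBLER-SCOPE.md`, «13th clause»).  In print the
fields `A` of (3.35)–(3.37) are 𝔤-valued, `𝔤 = 𝔲(N)` (p. 390 l. 16–18 «we assume only that ηA is in a sufficiently small neighbourhood of 0 in the Lie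
algebra 𝔤»): `U′ = e^{iηA}` with `A` hermitian, so every `e^{itA(b)}` is unitary.  The tree's member-assembler TARGET
(t2s-1 g17, p700891) displays the (3.35) cube data through TWELVE clauses on `(u_□, A_□, Q_□, C_□, ξ_□, Λ_□)` at a unitary background `U` — bi-contractive gauges
`u_□`, `U^{u_□} = e^{iηA_□}` on the bonds of `Q_□`, `‖A_□‖ ≤ C_□ξ_□⁻¹`, `‖η⁻¹∂A_□‖ ≤ C_□ξ_□⁻²` on `Q_□`, `L^{j+1}η ≤ Λ_□ξ_□`, `max(C_□, C_□(1+D₁θ))Λ_□² ≤ ¼` — and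
NOT the hermiticity of `A_□`, while the located-letter suppliers of M5.1b-G (family 4, the defect family, the `O_□` blocks) display a thirteenth clause
`∀ t κ x, ‖exp((it)A_□(κ, x))‖ ≤ 1`, false for a non-hermitian `A_□(b)` and unconstrained by the twelve clauses OFF the bonds of `Q_□`.  THIS FILE closes
the gap honestly, WITHOUT touching the target: (i) a bi-contractive invertible matrix is unitary (L²-operator norm), so `U^{u_□}(b)` is unitary; (ii) on the
bonds of `Q_□`, `e^{iηA_□(b)} = U^{u_□}(b)` is unitary and `‖iηA_□(b)‖ ≤ C_□Λ_□∕L^{j+1} ≤ ⅛`, hence `iηA_□(b)` is skew-adjoint by [B7] (22)–(23) (b07's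
`star_mlog_eq_neg` with `log ∘ exp = id`, `B7BlockAvgLog.mlog_exp`) — i.e. `A_□(b)` IS hermitian on the bonds the clauses constrain; (iii) therefore the
hermitian parts `A_□ʰ := ½(A_□ + A_□⋆)` agree with `A_□` on those bonds, obey the same norm and flat-derivative bounds everywhere they are asked (the flat
derivative is real-linear and `‖½(a + a⋆)‖ ≤ ‖a‖`), and `e^{itA_□ʰ(b)}` is unitary for EVERY bond.  The assembler feeds `A_□ʰ` to all packages.

WHAT THIS FILE PROVES (theorems only; 0 `def`, 0 `def … : Prop`, 0 sorry; standard axioms).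
* §1 (any C⋆-algebra; private helpers `star_half_add_star`, `norm_half_add_star_le`, `half_add_star_of_star_eq`, `real_smul_half_add_star`,
  `I_mul_real_smul_mem_skewAdjoint`, `exp_I_mul_smul_mem_unitary`, `norm_exp_I_mul_smul_le_one` — `a⋆ = a ⇒ e^{ita}` unitary, `‖e^{ita}‖ ≤ 1`)
  ★ `star_eq_neg_of_exp_mem_unitary` (`‖X‖ ≤ ⅛`, `e^X` unitary ⇒ `X⋆ = −X`; [B7] (22)–(23)), `star_eq_of_exp_I_smul_mem_unitary` (`η ≠ 0`, `‖iηa‖ ≤ ⅛`,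
  `e^{iηa}` unitary ⇒ `a⋆ = a`).
* §2 (the matrix fibre, L²-operator norm) ★ `mem_unitary_of_bicontractive` ∕ `mem_unitaryUnits_of_bicontractive` (`‖u‖ ≤ 1`, `‖u⁻¹‖ ≤ 1 ⇒ u` unitary:
  the tree's bi-contractive gauges of (3.28) are `U(N)`-valued); `val_fluct`, `covD_one_apply` (bookkeeping).
* §3 (the member) ★★★ `hermitianPart_cubeData` — from the clauses that mention `A_□` (and `u_□` bi-contractive, `U` unitary-valued): for the written-out
  hermitian part `Aʰ_□ = ½(A_□ + A_□⋆)`: `Aʰ_□(b)⋆ = Aʰ_□(b)`, the SAME three clauses (`U^{u_□} = e^{iηAʰ_□}` on the bonds of `Q_□`, `‖Aʰ_□‖ ≤ C_□ξ_□⁻¹`, `‖η⁻¹∂Aʰ_□‖ ≤ C_□ξ_□⁻²` on `Q_□`), the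
  thirteenth clause `‖e^{itAʰ_□(κ,x)}‖ ≤ 1` for all `t κ x`, and the localised configurations `Ṽ_□ = e^{iηχ̃_□Aʰ_□}` (`locCfgY`) unitary-valued.

HONEST SCOPE.  Linear algebra and [B7] (22)–(23) only; no estimate of [B9] is touched; the member-assembler target is consumed as printed in the tree (its
twelve clauses are NOT changed).  Count-neutral; no summit ∕ node statement proved; nothing continuum ∕ OS ∕ mass gap ∕ Clay; YM mass gap NOT proved.
`--supports stmt-QuantumFields-19200`.  RELATED, NOT DUPLICATED (searched 2026-08-29: `rg 'bicontractive.*unitary|unitary_of_norm|mem_unitary_of'` over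
Literature = ∅ for the L²-norm criterion; b07 `B7Prop2Explicit.star_mlog_eq_neg` ∕ `unitaryUnits_le_U1` (the converse direction) and b10
`B10Eq27AxialLog.I_smul_B27_mem_skewAdjoint` (the same device for a holonomy) are used BY NAME or are different statements).
-/

noncomputable section

namespace Literature.MathematicalPhysics.QuantumFieldTheory.Balaban1983to89.B9CubeDataHermitianPart

open NormedSpace Complex
open B7Prop2Explicit (unitaryUnits mem_unitaryUnits star_mlog_eq_neg)
open B7BlockAvgLog (mlog_exp)
open MatrixLog (mlog)
open B6KLevelCensusIndexV1 (KIdx kGeo)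
open B6Cover236MultiLevelBlocks (cubes)
open B6GlobalChartV1 (PV boxEquiv)
open B9BackgroundsKLevelV1 (shiftsV1 eta_pos_L_one_le_M_pos)
open B9Eq39Adjoint (fluct covD R)
open B9Eq360DeltaPrimeAY (AfldY mulY)
open B9Cor36CutoffField337 (cutFldY)
open B9Cor36CubeCutoffs (locCfgY chiTY)
open B4PartitionUnity22 (thetaProf D1)
open Node00 (CfgY GaugeY toKT gaugeY gaugeY_apply)

/-! ## §1 The Hermitian part and the logarithm of a unitary, in a C⋆-algebra -/

section CStar

variable {𝔸 : Type*} [CStarAlgebra 𝔸]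

/-- `(½(a + a⋆))⋆ = ½(a + a⋆)`. [folklore] -/
private theorem star_half_add_star (a : 𝔸) : star ((2 : ℂ)⁻¹ • (a + star a)) = (2 : ℂ)⁻¹ • (a + star a) := by
  rw [star_smul, star_add, star_star, add_comm (star a) a]
  congr 1
  simp

/-- `‖½(a + a⋆)‖ ≤ ‖a‖` (the involution is isometric). [folklore] -/
private theorem norm_half_add_star_le (a : 𝔸) : ‖(2 : ℂ)⁻¹ • (a + star a)‖ ≤ ‖a‖ := by
  calc ‖(2 : ℂ)⁻¹ • (a + star a)‖ ≤ ‖(2 : ℂ)⁻¹‖ * (‖a‖ + ‖star a‖) :=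
        (norm_smul_le _ _).trans (mul_le_mul_of_nonneg_left (norm_add_le _ _) (norm_nonneg _))
    _ = ‖a‖ := by rw [norm_star, norm_inv]; norm_num; ring

/-- a hermitian element is its own Hermitian part. [folklore] -/
private theorem half_add_star_of_star_eq {a : 𝔸} (h : star a = a) : (2 : ℂ)⁻¹ • (a + star a) = a := by
  rw [h, ← two_smul ℂ a, smul_smul, inv_mul_cancel₀ (two_ne_zero), one_smul]

/-- the Hermitian part is real-linear: `½(ra + (ra)⋆) = r·½(a + a⋆)` for real `r`. [folklore] -/
private theorem real_smul_half_add_star (r : ℝ) (a : 𝔸) :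
    (2 : ℂ)⁻¹ • ((r : ℂ) • a + star ((r : ℂ) • a)) = (r : ℂ) • ((2 : ℂ)⁻¹ • (a + star a)) := by
  rw [star_smul, Complex.star_def, Complex.conj_ofReal, ← smul_add, smul_comm]

/-- `ita` is skew-adjoint for hermitian `a` and real `t`. [folklore] -/
private theorem I_mul_real_smul_mem_skewAdjoint {a : 𝔸} (h : star a = a) (t : ℝ) : ((I * (t : ℂ))) • a ∈ skewAdjoint 𝔸 := by
  rw [skewAdjoint.mem_iff, star_smul, h, ← neg_smul]
  congr 1
  rw [Complex.star_def, map_mul, Complex.conj_I, Complex.conj_ofReal, neg_mul]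

/-- `e^{ita}` is unitary for hermitian `a` and real `t`. [folklore] -/
private theorem exp_I_mul_smul_mem_unitary {a : 𝔸} (h : star a = a) (t : ℝ) : exp ((I * (t : ℂ)) • a) ∈ unitary 𝔸 := by
  letI : NormedAlgebra ℚ 𝔸 := NormedAlgebra.restrictScalars ℚ ℂ 𝔸
  exact exp_mem_unitary_of_mem_skewAdjoint (I_mul_real_smul_mem_skewAdjoint h t)

/-- **`‖e^{ita}‖ ≤ 1` for hermitian `a` and real `t`** (`e^{ita}` is unitary). [folklore] -/
private theorem norm_exp_I_mul_smul_le_one [Nontrivial 𝔸] {a : 𝔸} (h : star a = a) (t : ℝ) : ‖exp ((I * (t : ℂ)) • a)‖ ≤ 1 :=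
  (CStarRing.norm_of_mem_unitary (exp_I_mul_smul_mem_unitary h t)).le

/-- ★ **THE LOGARITHM OF A UNITARY NEAR `1` IS SKEW-ADJOINT, EXPONENTIAL FORM**: `‖X‖ ≤ ⅛` and `e^X` unitary ⇒ `X⋆ = −X` ([B7] (22)–(23): `‖e^X − 1‖ ≤ e^{⅛} − 1
≤ ¼`, `log e^X = X` for `‖X‖ < ln 2`, `(log u)⋆ = −log u`). [cite: Balaban1985Averaging, (22)–(23) p.21] -/
theorem star_eq_neg_of_exp_mem_unitary {X : 𝔸} (hX : ‖X‖ ≤ 1 / 8) (hu : exp X ∈ unitary 𝔸) : star X = -X := by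
  have hlog2 : ‖X‖ < Real.log 2 := lt_of_le_of_lt hX (by have := Real.log_two_gt_d9; linarith)
  have h1 : ‖exp X - 1‖ ≤ 1 / 4 := by
    have h := Literature.Analysis.Calculus.norm_exp_sub_one_le X
    have hl : (1 : ℝ) / 8 ≤ Real.log (5 / 4) := by
      have := Real.one_sub_inv_le_log_of_pos (show (0 : ℝ) < 5 / 4 by norm_num)
      norm_num at this ⊢
      linarith
    have h54 : Real.exp ‖X‖ ≤ 5 / 4 := by
      calc Real.exp ‖X‖ ≤ Real.exp (Real.log (5 / 4)) := Real.exp_le_exp.mpr (hX.trans hl)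
        _ = 5 / 4 := Real.exp_log (by norm_num)
    linarith
  have h2 := star_mlog_eq_neg hu h1
  rwa [mlog_exp hlog2] at h2

/-- **`e^{iηa}` unitary with `‖iηa‖ ≤ ⅛`, `η ≠ 0` ⇒ `a` hermitian.** [cite: Balaban1985Averaging, (22)–(23) p.21] -/
theorem star_eq_of_exp_I_smul_mem_unitary {a : 𝔸} {η : ℝ} (hη : η ≠ 0) (hX : ‖((I * (η : ℂ))) • a‖ ≤ 1 / 8)
    (hu : exp (((I * (η : ℂ))) • a) ∈ unitary 𝔸) : star a = a := by
  have h := star_eq_neg_of_exp_mem_unitary hX hu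
  rw [star_smul, ← neg_smul, Complex.star_def, map_mul, Complex.conj_I, Complex.conj_ofReal, neg_mul] at h
  exact smul_right_injective 𝔸 (neg_ne_zero.mpr (mul_ne_zero I_ne_zero (ofReal_ne_zero.mpr hη))) h

end CStar

/-! ## §2 A bi-contractive invertible matrix is unitary (L²-operator norm) -/

section MatrixFibre

open scoped Matrix Matrix.Norms.L2Operator

variable {N : ℕ}

/-- ★ **`‖u‖ ≤ 1` and `‖u⁻¹‖ ≤ 1` ⇒ `u` unitary** for `u ∈ GL_N(ℂ)` in the L²-operator norm: `‖uv‖ ≤ ‖v‖ = ‖u⁻¹(uv)‖ ≤ ‖uv‖`, so `u` is an isometry of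
`ℂ^N`, `u⋆u = 1` (`ContinuousLinearMap.norm_map_iff_adjoint_comp_self` through `Matrix.toEuclideanCLM`), and `uu⋆ = 1` on the finite-dimensional space —
the form in which the tree's bi-contractive gauges `u : T_η → G`, `G = U(N)`, of (3.28) are unitary-valued.
[cite: Balaban1985BackgroundPropagators, (3.28) p.395, bookkeeping] -/
theorem mem_unitary_of_bicontractive (u : (Matrix (Fin N) (Fin N) ℂ)ˣ) (h1 : ‖(u : Matrix (Fin N) (Fin N) ℂ)‖ ≤ 1)
    (h2 : ‖((u⁻¹ : (Matrix (Fin N) (Fin N) ℂ)ˣ) : Matrix (Fin N) (Fin N) ℂ)‖ ≤ 1) :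
    (u : Matrix (Fin N) (Fin N) ℂ) ∈ unitary (Matrix (Fin N) (Fin N) ℂ) := by
  set G := Matrix.toEuclideanCLM (n := Fin N) (𝕜 := ℂ) (u : Matrix (Fin N) (Fin N) ℂ) with hG
  set G' := Matrix.toEuclideanCLM (n := Fin N) (𝕜 := ℂ) ((u⁻¹ : (Matrix (Fin N) (Fin N) ℂ)ˣ) : Matrix (Fin N) (Fin N) ℂ) with hG'
  have hGG' : ∀ v, G' (G v) = v := fun v => by
    have h : G' * G = 1 := by rw [hG', hG, ← map_mul, Units.inv_mul, map_one]
    simpa using congrArg (fun T : EuclideanSpace ℂ (Fin N) →L[ℂ] EuclideanSpace ℂ (Fin N) => T v) h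
  have hnG : ‖G‖ ≤ 1 := by rw [hG, Matrix.l2_opNorm_toEuclideanCLM]; exact h1
  have hnG' : ‖G'‖ ≤ 1 := by rw [hG', Matrix.l2_opNorm_toEuclideanCLM]; exact h2
  have hiso : ∀ v, ‖G v‖ = ‖v‖ := fun v => le_antisymm
    ((G.le_opNorm v).trans ((mul_le_mul_of_nonneg_right hnG (norm_nonneg _)).trans_eq (one_mul _)))
    (calc ‖v‖ = ‖G' (G v)‖ := by rw [hGG']
      _ ≤ ‖G'‖ * ‖G v‖ := G'.le_opNorm _
      _ ≤ 1 * ‖G v‖ := mul_le_mul_of_nonneg_right hnG' (norm_nonneg _)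
      _ = ‖G v‖ := one_mul _)
  have hadj : ContinuousLinearMap.adjoint G ∘L G = 1 := (ContinuousLinearMap.norm_map_iff_adjoint_comp_self G).mp hiso
  have key : Matrix.toEuclideanCLM (n := Fin N) (𝕜 := ℂ) (star (u : Matrix (Fin N) (Fin N) ℂ) * u) =
      Matrix.toEuclideanCLM (n := Fin N) (𝕜 := ℂ) 1 := by
    rw [map_mul, map_star (Matrix.toEuclideanCLM (n := Fin N) (𝕜 := ℂ)), map_one, ← hG, ContinuousLinearMap.star_eq_adjoint]
    exact hadj
  have hstar : star (u : Matrix (Fin N) (Fin N) ℂ) * u = 1 := (Matrix.toEuclideanCLM (n := Fin N) (𝕜 := ℂ)).injective key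
  exact Unitary.mem_iff.mpr ⟨hstar, mul_eq_one_comm.mp hstar⟩

/-- units version: bi-contractive `u ∈ GL_N(ℂ)` lies in b07's subgroup `unitaryUnits` (the gauge group `G = U(N)` of (3.28)).
[cite: Balaban1985BackgroundPropagators, (3.28) p.395, bookkeeping] -/
theorem mem_unitaryUnits_of_bicontractive (u : (Matrix (Fin N) (Fin N) ℂ)ˣ) (h1 : ‖(u : Matrix (Fin N) (Fin N) ℂ)‖ ≤ 1)
    (h2 : ‖((u⁻¹ : (Matrix (Fin N) (Fin N) ℂ)ˣ) : Matrix (Fin N) (Fin N) ℂ)‖ ≤ 1) :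
    u ∈ unitaryUnits (Matrix (Fin N) (Fin N) ℂ) :=
  mem_unitaryUnits.mpr (mem_unitary_of_bicontractive u h1 h2)

end MatrixFibre

/-! ## §3 ★★★ The Hermitian representative of the (3.35) cube data at the member -/

section Member

open scoped Matrix Matrix.Norms.L2Operator

variable {d ℓ : ℕ} {hd : 1 ≤ d + 1} {hL : Odd (ℓ + 1) ∧ 1 < ℓ + 1} {b₀ b₁ : ℝ} {N : ℕ} [NeZero N]

/-- the value of the fluctuation unit: `U′(b) = e^{iηA(b)}`. [cite: Balaban1985BackgroundPropagators, p.390 («U′ = exp iηA»), bookkeeping] -/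
theorem val_fluct {𝔸 : Type} [NormedRing 𝔸] [NormedAlgebra ℂ 𝔸] [CompleteSpace 𝔸] (i : KIdx d ℓ hd hL b₀ b₁) (η : ℝ) (A : AfldY 𝔸 i)
    (κ : Fin (d + 1)) (x : Site (PV d ℓ i.m i.K hd hL) 0) :
    ((fluct η A κ x : 𝔸ˣ) : 𝔸) = exp (((I * (η : ℂ))) • A κ x) := by
  simp [fluct]

/-- the flat bond derivative (transporters `≡ 1`) is the plain difference. [cite: Balaban1985BackgroundPropagators, (3.3) p.390, bookkeeping] -/
theorem covD_one_apply {𝔸 : Type} [NormedRing 𝔸] [NormedAlgebra ℂ 𝔸] [CompleteSpace 𝔸] (i : KIdx d ℓ hd hL b₀ b₁)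
    (f : Site (PV d ℓ i.m i.K hd hL) 0 → 𝔸) (μ : Fin (d + 1)) (x : Site (PV d ℓ i.m i.K hd hL) 0) :
    covD (shiftsV1 (PV d ℓ i.m i.K hd hL)) (fun _ _ => (1 : 𝔸ˣ)) μ f x = f (shiftsV1 (PV d ℓ i.m i.K hd hL) μ x) - f x := by
  simp [covD, R]

/-- ★★★ **THE HERMITIAN REPRESENTATIVE OF THE (3.35) CUBE DATA.**  At a member `i`, a unitary-valued background `U`, bi-contractive gauges `u_□` and data
`(A_□, Q_□, C_□, ξ_□, Λ_□)` with `0 ≤ C_□`, `0 < ξ_□`, `1 ≤ Λ_□`, `L^{j+1}η ≤ Λ_□ξ_□`, `U^{u_□} = e^{iηA_□}` on the bonds of `Q_□`, `‖A_□‖ ≤ C_□ξ_□⁻¹` and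
`‖η⁻¹∂A_□‖ ≤ C_□ξ_□⁻²` on `Q_□`, `max(C_□, C_□(1 + D₁θ))Λ_□² ≤ ¼` (the clauses of the member assembler's target that mention `A_□`; `ℓ ≥ 1`), the
HERMITIAN family `Aʰ_□ := ½(A_□ + A_□⋆)` (written out, no definition is introduced) satisfies the same three clauses, the located letters' thirteenth clause
`‖e^{itAʰ_□(κ,x)}‖ ≤ 1` for all `t, κ, x`, and `Ṽ_□ = e^{iηχ̃_□Aʰ_□}` is unitary-valued.  In print `A` is `𝔲(N)`-valued from the start (p. 390 l. 16–18 «we assume only that ηA is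
in a sufficiently small neighbourhood of 0 in the Lie algebra 𝔤»); here hermiticity on the bonds of
`Q_□` is DERIVED: `e^{iηA_□(b)} = U^{u_□}(b)` is unitary (§2) and `‖iηA_□(b)‖ ≤ C_□Λ_□∕L^{j+1} ≤ ⅛`, so [B7] (22)–(23) applies (§1).
[cite: Balaban1985BackgroundPropagators, (3.35)–(3.37) p.396, p.390 l.16–18, Cor. 3.6 p.408 («U′ = U^u = e^{iηA}»), (3.28) p.395; Balaban1985Averaging, (22)–(23) p.21] -/
theorem hermitianPart_cubeData (hℓ : 1 ≤ ℓ) (i : KIdx d ℓ hd hL b₀ b₁)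
    (U : CfgY (Matrix (Fin N) (Fin N) ℂ) i) (hUu : ∀ μ x, U μ x ∈ unitaryUnits (Matrix (Fin N) (Fin N) ℂ))
    (g : ↥(cubes (toKT i).D.toDomains) → GaugeY (Matrix (Fin N) (Fin N) ℂ) i)
    (hg : ∀ c x, ‖(g c x : Matrix (Fin N) (Fin N) ℂ)‖ ≤ 1 ∧ ‖(((g c x)⁻¹ : (Matrix (Fin N) (Fin N) ℂ)ˣ) : Matrix (Fin N) (Fin N) ℂ)‖ ≤ 1)
    (A : ↥(cubes (toKT i).D.toDomains) → AfldY (Matrix (Fin N) (Fin N) ℂ) i)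
    (Q : ↥(cubes (toKT i).D.toDomains) → Set (Site (PV d ℓ i.m i.K hd hL) 0)) (C ξ Λ : ↥(cubes (toKT i).D.toDomains) → ℝ)
    (hC0 : ∀ c, 0 ≤ C c) (hξ : ∀ c, 0 < ξ c) (hΛ : ∀ c, 1 ≤ Λ c)
    (hΛξ : ∀ c, LatticeNorms.scaleLen ((ℓ : ℝ) + 1) (kGeo i).eta (c.1.1 + 1) ≤ Λ c * ξ c)
    (hgA : ∀ c (κ : Fin (d + 1)) (x : Site (PV d ℓ i.m i.K hd hL) 0), x ∈ Q c → x.shift κ ∈ Q c →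
      gaugeY i (g c) U κ x = fluct (kGeo i).eta (A c) κ x)
    (hAb : ∀ c, ∀ κ, ∀ x ∈ Q c, ‖A c κ x‖ ≤ C c * (ξ c)⁻¹)
    (hdA : ∀ c, ∀ μ ν, ∀ x ∈ Q c,
      ‖(((kGeo i).eta : ℂ)⁻¹) • covD (shiftsV1 (PV d ℓ i.m i.K hd hL)) (fun _ _ => (1 : (Matrix (Fin N) (Fin N) ℂ)ˣ)) μ (A c ν) x‖ ≤ C c * (ξ c ^ 2)⁻¹)
    (hs₄ : ∀ c, max (C c) (C c * (1 + D1 thetaProf)) * Λ c ^ 2 ≤ 1 / 4) :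
    (∀ c (κ : Fin (d + 1)) (x : Site (PV d ℓ i.m i.K hd hL) 0),
        star ((2 : ℂ)⁻¹ • (A c κ x + star (A c κ x))) = (2 : ℂ)⁻¹ • (A c κ x + star (A c κ x))) ∧
      (∀ c (κ : Fin (d + 1)) (x : Site (PV d ℓ i.m i.K hd hL) 0), x ∈ Q c → x.shift κ ∈ Q c →
        gaugeY i (g c) U κ x = fluct (kGeo i).eta (fun κ' x' => (2 : ℂ)⁻¹ • (A c κ' x' + star (A c κ' x'))) κ x) ∧
      (∀ c, ∀ κ, ∀ x ∈ Q c, ‖(2 : ℂ)⁻¹ • (A c κ x + star (A c κ x))‖ ≤ C c * (ξ c)⁻¹) ∧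
      (∀ c, ∀ μ ν, ∀ x ∈ Q c,
        ‖(((kGeo i).eta : ℂ)⁻¹) • covD (shiftsV1 (PV d ℓ i.m i.K hd hL)) (fun _ _ => (1 : (Matrix (Fin N) (Fin N) ℂ)ˣ)) μ
            (fun x' => (2 : ℂ)⁻¹ • (A c ν x' + star (A c ν x'))) x‖ ≤ C c * (ξ c ^ 2)⁻¹) ∧
      (∀ c (t : ℝ) (κ : Fin (d + 1)) (x : Site (PV d ℓ i.m i.K hd hL) 0),
        ‖exp ((I * (t : ℂ)) • ((2 : ℂ)⁻¹ • (A c κ x + star (A c κ x))))‖ ≤ 1) ∧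
      (∀ c (κ : Fin (d + 1)) (x : Site (PV d ℓ i.m i.K hd hL) 0),
        locCfgY i c (kGeo i).eta (fun κ' x' => (2 : ℂ)⁻¹ • (A c κ' x' + star (A c κ' x'))) κ x ∈ unitaryUnits (Matrix (Fin N) (Fin N) ℂ)) := by
  classical
  letI : CStarAlgebra (Matrix (Fin N) (Fin N) ℂ) := {}
  obtain ⟨hη, -, -⟩ := eta_pos_L_one_le_M_pos i
  have hL2 : (2 : ℝ) ≤ (ℓ : ℝ) + 1 := by
    have : (1 : ℝ) ≤ (ℓ : ℝ) := by exact_mod_cast hℓ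
    linarith
  -- the gauges are unitary (§2)
  have hgu : ∀ c x, g c x ∈ unitaryUnits (Matrix (Fin N) (Fin N) ℂ) :=
    fun c x => mem_unitaryUnits_of_bicontractive (g c x) (hg c x).1 (hg c x).2
  -- `‖iηA_□(b)‖ ≤ ⅛` on `Q_□`
  have hsmall : ∀ c κ x, x ∈ Q c → ‖((I * (((kGeo i).eta : ℝ) : ℂ))) • A c κ x‖ ≤ 1 / 8 := by
    intro c κ x hx
    have hP : (0 : ℝ) < ((ℓ : ℝ) + 1) ^ (c.1.1 + 1) := by positivity
    have hP2 : (2 : ℝ) ≤ ((ℓ : ℝ) + 1) ^ (c.1.1 + 1) := hL2.trans (le_self_pow₀ (by linarith) (by omega))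
    have h1 : ((ℓ : ℝ) + 1) ^ (c.1.1 + 1) * (kGeo i).eta ≤ Λ c * ξ c := hΛξ c
    have hCΛ : C c * Λ c ≤ 1 / 4 := by
      have h2 : C c * Λ c ≤ C c * Λ c ^ 2 := by
        have h := mul_le_mul_of_nonneg_left (hΛ c) (mul_nonneg (hC0 c) (zero_le_one.trans (hΛ c)))
        calc C c * Λ c = C c * Λ c * 1 := (mul_one _).symm
          _ ≤ C c * Λ c * Λ c := h
          _ = C c * Λ c ^ 2 := by ring
      exact h2.trans ((mul_le_mul_of_nonneg_right (le_max_left _ _) (sq_nonneg _)).trans (hs₄ c))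
    have hmain : (kGeo i).eta * (C c * (ξ c)⁻¹) * ((ℓ : ℝ) + 1) ^ (c.1.1 + 1) ≤ 1 / 4 := by
      have hξ0 : (ξ c) ≠ 0 := (hξ c).ne'
      calc (kGeo i).eta * (C c * (ξ c)⁻¹) * ((ℓ : ℝ) + 1) ^ (c.1.1 + 1)
          = C c * ((((ℓ : ℝ) + 1) ^ (c.1.1 + 1) * (kGeo i).eta) * (ξ c)⁻¹) := by ring
        _ ≤ C c * ((Λ c * ξ c) * (ξ c)⁻¹) :=
          mul_le_mul_of_nonneg_left (mul_le_mul_of_nonneg_right h1 (inv_nonneg.2 (hξ c).le)) (hC0 c)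
        _ = C c * Λ c := by rw [mul_assoc, mul_inv_cancel₀ hξ0, mul_one]
        _ ≤ 1 / 4 := hCΛ
    have hq : (kGeo i).eta * (C c * (ξ c)⁻¹) ≤ 1 / 8 := by
      have h3 : (kGeo i).eta * (C c * (ξ c)⁻¹) ≤ 1 / 4 / ((ℓ : ℝ) + 1) ^ (c.1.1 + 1) := (le_div_iff₀ hP).mpr hmain
      have h4 : 1 / 4 / ((ℓ : ℝ) + 1) ^ (c.1.1 + 1) ≤ 1 / 4 / 2 := div_le_div_of_nonneg_left (by norm_num) (by norm_num) hP2
      linarith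
    calc ‖((I * (((kGeo i).eta : ℝ) : ℂ))) • A c κ x‖ = (kGeo i).eta * ‖A c κ x‖ := by
          rw [norm_smul, norm_mul, Complex.norm_I, one_mul, Complex.norm_real, Real.norm_of_nonneg hη.le]
      _ ≤ (kGeo i).eta * (C c * (ξ c)⁻¹) := mul_le_mul_of_nonneg_left (hAb c κ x hx) hη.le
      _ ≤ 1 / 8 := hq
  -- on the bonds of `Q_□`, `e^{iηA_□(b)} = U^{u_□}(b)` is unitary, hence `A_□(b)` is hermitian
  have hA : ∀ c κ x, x ∈ Q c → x.shift κ ∈ Q c → star (A c κ x) = A c κ x := by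
    intro c κ x hx hx'
    have hfu : fluct (kGeo i).eta (A c) κ x ∈ unitaryUnits (Matrix (Fin N) (Fin N) ℂ) := by
      rw [← hgA c κ x hx hx', gaugeY_apply]
      exact Subgroup.mul_mem _ (Subgroup.mul_mem _ (hgu c x) (hUu κ x)) (Subgroup.inv_mem _ (hgu c _))
    have hexp : exp (((I * (((kGeo i).eta : ℝ) : ℂ))) • A c κ x) ∈ unitary (Matrix (Fin N) (Fin N) ℂ) := by
      rw [← val_fluct i (kGeo i).eta (A c) κ x]
      exact mem_unitaryUnits.mp hfu
    exact star_eq_of_exp_I_smul_mem_unitary hη.ne' (hsmall c κ x hx) hexp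
  refine ⟨fun c κ x => star_half_add_star _, ?_, ?_, ?_, ?_, ?_⟩
  · -- `U^{u_□} = e^{iηAʰ_□}` on the bonds of `Q_□`
    intro c κ x hx hx'
    rw [hgA c κ x hx hx']
    ext1
    rw [val_fluct, val_fluct]
    dsimp only
    rw [half_add_star_of_star_eq (hA c κ x hx hx')]
  · -- `‖Aʰ_□‖ ≤ C_□ξ_□⁻¹` on `Q_□`
    intro c κ x hx
    exact (norm_half_add_star_le _).trans (hAb c κ x hx)
  · -- the flat derivative bound
    intro c μ ν x hx
    have hlin : covD (shiftsV1 (PV d ℓ i.m i.K hd hL)) (fun _ _ => (1 : (Matrix (Fin N) (Fin N) ℂ)ˣ)) μ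
        (fun y => (2 : ℂ)⁻¹ • (A c ν y + star (A c ν y))) x =
        (2 : ℂ)⁻¹ • (covD (shiftsV1 (PV d ℓ i.m i.K hd hL)) (fun _ _ => (1 : (Matrix (Fin N) (Fin N) ℂ)ˣ)) μ (A c ν) x +
          star (covD (shiftsV1 (PV d ℓ i.m i.K hd hL)) (fun _ _ => (1 : (Matrix (Fin N) (Fin N) ℂ)ˣ)) μ (A c ν) x)) := by
      rw [covD_one_apply, covD_one_apply, star_sub, ← smul_sub]
      congr 1
      abel
    have hre : (((kGeo i).eta : ℂ)⁻¹) • ((2 : ℂ)⁻¹ •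
        (covD (shiftsV1 (PV d ℓ i.m i.K hd hL)) (fun _ _ => (1 : (Matrix (Fin N) (Fin N) ℂ)ˣ)) μ (A c ν) x +
          star (covD (shiftsV1 (PV d ℓ i.m i.K hd hL)) (fun _ _ => (1 : (Matrix (Fin N) (Fin N) ℂ)ˣ)) μ (A c ν) x))) =
        (2 : ℂ)⁻¹ • ((((kGeo i).eta : ℂ)⁻¹) • covD (shiftsV1 (PV d ℓ i.m i.K hd hL)) (fun _ _ => (1 : (Matrix (Fin N) (Fin N) ℂ)ˣ)) μ (A c ν) x +
          star ((((kGeo i).eta : ℂ)⁻¹) • covD (shiftsV1 (PV d ℓ i.m i.K hd hL)) (fun _ _ => (1 : (Matrix (Fin N) (Fin N) ℂ)ˣ)) μ (A c ν) x)) := by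
      rw [← Complex.ofReal_inv, real_smul_half_add_star]
    show ‖(((kGeo i).eta : ℂ)⁻¹) • covD (shiftsV1 (PV d ℓ i.m i.K hd hL)) (fun _ _ => (1 : (Matrix (Fin N) (Fin N) ℂ)ˣ)) μ
        (fun y => (2 : ℂ)⁻¹ • (A c ν y + star (A c ν y))) x‖ ≤ C c * (ξ c ^ 2)⁻¹
    rw [hlin, hre]
    exact (norm_half_add_star_le _).trans (hdA c μ ν x hx)
  · -- the thirteenth clause, everywhere
    intro c t κ x
    exact norm_exp_I_mul_smul_le_one (star_half_add_star _) t
  · -- `Ṽ_□` is unitary-valued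
    intro c κ x
    rw [mem_unitaryUnits, B9Cor36CubeCutoffs.locCfgY_apply, val_fluct]
    refine exp_I_mul_smul_mem_unitary ?_ _
    show star ((((chiTY i c (boxEquiv i.hN x) : ℝ)) : ℂ) • ((2 : ℂ)⁻¹ • (A c κ x + star (A c κ x)))) =
      (((chiTY i c (boxEquiv i.hN x) : ℝ)) : ℂ) • ((2 : ℂ)⁻¹ • (A c κ x + star (A c κ x)))
    rw [star_smul, Complex.star_def, Complex.conj_ofReal, star_half_add_star]

end Member

end Literature.MathematicalPhysics.QuantumFieldTheory.Balaban1983to89.B9CubeDataHermitianPart
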